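import Literature.NumberTheory.ConnesConsani2023.ZetaCyclesFiniteSections
import Literature.NumberTheory.ConnesConsani2023.ZetaCyclesCoreProofs
import Literature.NumberTheory.LFunctions.YoshidaWindowL2Density
import HarnessLib

/-!
# ζ-cycles, §2.1.2: consequences of the core property (Lemma 2.2) — Prop. 2.3 and Cor. 2.4

RH-FREE (label, line 1).  Third proof file of
`Literature/NumberTheory/ConnesConsani2023/ZetaCyclesSemilocalForm.lean` (Connes–Consani, *Spectral
triples and ζ-cycles*, Enseign. Math. **69** (2023) 93–148, §2.1.2, p. 104–106
[cite: ConnesConsani2023, Prop. 2.3 and Cor. 2.4 p. 106]).  The statement file types three named facts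
for §2.1.2 beyond Prop. 2.1: `lemma_2_2` (the Laurent polynomials `E = ∪ E_N` form a CORE of `QW_λ`
for the graph norm `‖ξ‖² + ‖ξ̂‖₁²`), `prop_2_3` (lower semicontinuous relaxation from `E`) and
`cor_2_4` (the lower bound of `QW_λ` is the limit of the smallest eigenvalues of the finite sections
`E_N`).  The printed proofs of Prop. 2.3 and Cor. 2.4 are two lines each GIVEN Lemma 2.2 («it follows
from Lemma 2.2 using Proposition 2.1», p. 106); this file formalizes exactly those two deductions, so
that the three facts reduce to the single analytic fact `lemma_2_2`:

* §A `prop_2_3_i` — clause (i) of Prop. 2.3 (the lower-limit inequality (2.20) along ANY sequence of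
  Laurent polynomials converging in `L²`) holds UNCONDITIONALLY: it is the lower semicontinuity of
  Prop. 2.1 (`semilocalWeilForm_le_liminf`) restricted to `E ⊆ Dom(QW_λ)` (`mem_formDomain_of_mem_W`).
* §B off the domain every `L²`-approximating sequence has `QW_λ(η_n) → +∞`
  (`tendsto_semilocalWeilForm_top_of_not_lt_top`).
* §C on the domain, Lemma 2.2 gives Laurent polynomials `η_n → ξ` in the graph norm, hence in `L²`
  with `QW_λ(η_n) → QW_λ(ξ)` (`exists_laurent_recovery_of_mem_formDomain`, using the graph-norm
  continuity `tendsto_semilocalWeilForm_of_energy` of the sibling proof file); whence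
  `prop_2_3_of_lemma_2_2 : lemma_2_2 → prop_2_3`, using the `L²`-density of `E` in `L²([−a, a])`
  (`Literature.NumberTheory.LFunctions.Yoshida1992.exists_W_seq_tendsto_integral_norm_sq` of
  `YoshidaWindowL2Density.lean`, restated here as `exists_laurent_tendsto_integral_norm_sq`).
* §D `cor_2_4_of_lemma_2_2 : lemma_2_2 → cor_2_4`: homogeneity `E_N(c η) = |c|² E_N(η)`,
  normalisation of the recovery sequence, and the monotone half `tendsto_finiteSectionMin_iInf` of
  `ZetaCyclesFiniteSections.lean`.
* §E the DISCHARGES `prop_2_3_holds : prop_2_3` and `cor_2_4_holds : cor_2_4`, from §C/§D and the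
  tree theorem `lemma_2_2_holds` (Lemma 2.2, `ZetaCyclesCoreProofs.lean`, cc-t15).

No new definition, no named fact. Nothing here bears on the truth of the Riemann hypothesis.
-/

noncomputable section

open Complex Filter Set MeasureTheory
open scoped Real Topology ENNReal ComplexConjugate

namespace Literature.NumberTheory.ConnesConsani2023

open Literature.NumberTheory.LFunctions


variable {a : ℝ}

/-! ## §A Prop. 2.3 (i): the lower-limit inequality along Laurent polynomials (unconditional) -/

/-- A Laurent polynomial (an element of some `E_N = W a N`) lies in the form domain `Dom(QW_λ)`
(`U^n ∈ Dom(Q_∞)`, eq. (2.13)). [cite: ConnesConsani2023, Lemma 2.2 eq. (2.13), p. 104 (arXiv chunk p0006:L83–p0007:L3)] -/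
theorem IsLaurentPolynomial.mem_formDomain (ha : 0 < a) {η : ℝ → ℂ}
    (hη : IsLaurentPolynomial a η) : η ∈ formDomain a := by
  obtain ⟨N, hN⟩ := hη
  exact mem_formDomain_of_mem_W ha hN

/-- A Laurent polynomial is a window-supported square-integrable function. [cite: ConnesConsani2023, Prop. 2.3 (E ⊂ L²([λ⁻¹,λ], d*u)), p. 106 (arXiv chunk p0007:L74)] -/
theorem IsLaurentPolynomial.memLp_and_support (ha : 0 < a) {η : ℝ → ℂ}
    (hη : IsLaurentPolynomial a η) :
    MemLp η 2 volume ∧ Function.support η ⊆ Icc (-a) a :=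
  ⟨(hη.mem_formDomain ha).1, (hη.mem_formDomain ha).2.1⟩

/-- **Prop. 2.3 (i), PROVED unconditionally**: for every sequence of Laurent polynomials `η_n → ξ` in
`L²([λ⁻¹, λ])` one has `QW_λ(ξ) ≤ liminf QW_λ(η_n)` (eq. (2.20)) — the lower semicontinuity of
Prop. 2.1 restricted to `E ⊆ Dom(QW_λ)`. [cite: ConnesConsani2023, Prop. 2.3 (i) eq. (2.20), p. 106 (arXiv chunk p0007:L74–L76)] -/
theorem semilocalWeilForm_le_liminf_of_isLaurentPolynomial (ha : 0 < a) {ξ : ℝ → ℂ}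
    (hξ : MemLp ξ 2 volume) (hξs : Function.support ξ ⊆ Icc (-a) a) {η : ℕ → ℝ → ℂ}
    (hη : ∀ n, IsLaurentPolynomial a (η n))
    (hconv : Tendsto (fun n ↦ ∫ x, ‖η n x - ξ x‖ ^ 2) atTop (𝓝 0)) :
    semilocalWeilForm a ξ ≤ liminf (fun n ↦ semilocalWeilForm a (η n)) atTop :=
  semilocalWeilForm_le_liminf ha hξ hξs (fun n ↦ (hη n).memLp_and_support ha) hconv

/-- **Prop. 2.3, first conjunct of the named fact `prop_2_3`** (PROVED): the lower-limit inequality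
(2.20) along Laurent polynomials, for every `λ > 1` and every `ξ ∈ L²([λ⁻¹, λ])`.
[cite: ConnesConsani2023, Prop. 2.3 (i) eq. (2.20), p. 106 (arXiv chunk p0007:L74–L76)] -/
theorem prop_2_3_i : ∀ a : ℝ, 0 < a → ∀ ξ : ℝ → ℂ, MemLp ξ 2 volume →
    Function.support ξ ⊆ Icc (-a) a →
    ∀ η : ℕ → ℝ → ℂ, (∀ n, IsLaurentPolynomial a (η n)) →
      Tendsto (fun n ↦ ∫ x, ‖η n x - ξ x‖ ^ 2) atTop (𝓝 0) →
      semilocalWeilForm a ξ ≤ liminf (fun n ↦ semilocalWeilForm a (η n)) atTop :=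
  fun _ ha _ hξ hξs _ hη hconv ↦
    semilocalWeilForm_le_liminf_of_isLaurentPolynomial ha hξ hξs hη hconv

/-! ## §B Off the domain: every approximating sequence diverges to `+∞` -/

/-- Off the form domain (`‖ξ̂‖₁ = ∞`, `QW_λ(ξ) = +∞`), EVERY window sequence `u_n → ξ` in `L²` has
`QW_λ(u_n) → +∞` (lower semicontinuity, Prop. 2.1). [cite: ConnesConsani2023, Prop. 2.3 (ii) with Prop. 2.1 (values in (−∞,+∞], lower semicontinuous), p. 103 and p. 106 (arXiv chunk p0006:L55, p0007:L76)] -/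
theorem tendsto_semilocalWeilForm_top_of_not_lt_top (ha : 0 < a) {ξ : ℝ → ℂ}
    (hξ : MemLp ξ 2 volume) (hξs : Function.support ξ ⊆ Icc (-a) a)
    (hE : ¬ logSobolevEnergy ξ < ∞) {u : ℕ → ℝ → ℂ}
    (hu : ∀ n, MemLp (u n) 2 volume ∧ Function.support (u n) ⊆ Icc (-a) a)
    (hconv : Tendsto (fun n ↦ ∫ x, ‖u n x - ξ x‖ ^ 2) atTop (𝓝 0)) :
    Tendsto (fun n ↦ semilocalWeilForm a (u n)) atTop (𝓝 ⊤) := by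
  have h := semilocalWeilForm_le_liminf ha hξ hξs hu hconv
  rw [semilocalWeilForm_of_not_lt_top hE, top_le_iff] at h
  rw [EReal.tendsto_nhds_top_iff_real]
  intro x
  exact Filter.eventually_lt_of_lt_liminf (by rw [h]; exact EReal.coe_lt_top x)

/-! ## §C On the domain: recovery sequences from the core property (Lemma 2.2) -/

/-- `‖(η − ξ)^‖₁² = ‖(ξ − η)^‖₁²`. [cite: ConnesConsani2023, Lemma 2.2 (the norm ‖·‖₁ of (2.14)), p. 104 (arXiv chunk p0007:L5)] -/
theorem logSobolevEnergy_sub_comm (ξ η : ℝ → ℂ) :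
    logSobolevEnergy (fun x ↦ η x - ξ x) = logSobolevEnergy (ξ - η) := by
  have e : (fun x ↦ η x - ξ x) = fun x ↦ (-1 : ℂ) * (ξ - η) x := by
    funext x
    simp only [Pi.sub_apply]
    ring
  rw [e, logSobolevEnergy_const_mul]
  simp

/-- **Lemma 2.2 as a sequence**: given the core property, every `ξ ∈ Dom(QW_λ)` is the limit IN THE
GRAPH NORM of a sequence of Laurent polynomials (`‖(η_n − ξ)^‖₁² → 0`). [cite: ConnesConsani2023, Lemma 2.2 (E is a core for the graph norm ‖ξ‖² + ‖ξ̂‖₁²), p. 104 (arXiv chunk p0006:L83–p0007:L9)] -/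
theorem exists_laurent_tendsto_energy (h : lemma_2_2) (ha : 0 < a) {ξ : ℝ → ℂ}
    (hξ : ξ ∈ formDomain a) :
    ∃ η : ℕ → ℝ → ℂ, (∀ n, IsLaurentPolynomial a (η n)) ∧
      Tendsto (fun n ↦ logSobolevEnergy (fun x ↦ η n x - ξ x)) atTop (𝓝 0) := by
  have hex : ∀ n : ℕ, ∃ η : ℝ → ℂ, IsLaurentPolynomial a η ∧
      logSobolevEnergy (fun x ↦ η x - ξ x) < ENNReal.ofReal (1 / ((n : ℝ) + 1)) := by
    intro n
    obtain ⟨N, η, hηW, hηE⟩ := h a ha ξ hξ (1 / ((n : ℝ) + 1)) (by positivity)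
    exact ⟨η, ⟨N, hηW⟩, by rwa [logSobolevEnergy_sub_comm]⟩
  choose η hηL hηE using hex
  refine ⟨η, hηL, ?_⟩
  have h0 : Tendsto (fun n : ℕ ↦ ENNReal.ofReal (1 / ((n : ℝ) + 1))) atTop (𝓝 0) := by
    have := ENNReal.tendsto_ofReal (tendsto_one_div_add_atTop_nhds_zero_nat)
    rwa [ENNReal.ofReal_zero] at this
  exact tendsto_of_tendsto_of_tendsto_of_le_of_le tendsto_const_nhds h0 (fun _ ↦ bot_le)
    fun n ↦ (hηE n).le

/-- **Prop. 2.3 (ii) on the domain, from Lemma 2.2** (PROVED implication): if `E` is a core, then every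
`ξ ∈ Dom(QW_λ)` is the `L²`-limit of Laurent polynomials `η_n` with `QW_λ(η_n) → QW_λ(ξ)` — the `η_n`
of Lemma 2.2 converge in the graph norm, and `F = QW_λ` is continuous on the domain for that norm.
[cite: ConnesConsani2023, Prop. 2.3 (ii) and its proof («follows from Lemma 2.2 using Proposition 2.1»), p. 106 (arXiv chunk p0007:L70–L80)] -/
theorem exists_laurent_recovery_of_mem_formDomain (h : lemma_2_2) (ha : 0 < a) {ξ : ℝ → ℂ}
    (hξ : ξ ∈ formDomain a) :
    ∃ η : ℕ → ℝ → ℂ, (∀ n, IsLaurentPolynomial a (η n)) ∧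
      Tendsto (fun n ↦ ∫ x, ‖η n x - ξ x‖ ^ 2) atTop (𝓝 0) ∧
      Tendsto (fun n ↦ semilocalWeilForm a (η n)) atTop (𝓝 (semilocalWeilForm a ξ)) := by
  obtain ⟨η, hηL, hconv⟩ := exists_laurent_tendsto_energy h ha hξ
  have hdom : ∀ n, η n ∈ formDomain a := fun n ↦ (hηL n).mem_formDomain ha
  exact ⟨η, hηL,
    tendsto_integral_norm_sq_sub_of_energy hξ.1 hξ.2.1 (fun n ↦ ⟨(hdom n).1, (hdom n).2.1⟩) hconv,
    tendsto_semilocalWeilForm_of_energy ha hξ hdom hconv⟩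

/-- **`E` is dense in `L²([λ⁻¹, λ])`**: every window-supported `ξ ∈ L²` is the `L²`-limit of Laurent
polynomials (the completeness of Yoshida's orthonormal basis `χ_n`, tree file
`YoshidaWindowL2Density.lean`). [cite: ConnesConsani2023, Prop. 2.3 (E ⊂ L²([λ⁻¹,λ], d*u) and (ii) for ξ off the domain), p. 106 (arXiv chunk p0007:L74–L80)] -/
theorem exists_laurent_tendsto_integral_norm_sq (ha : 0 < a) {ξ : ℝ → ℂ} (hξ : MemLp ξ 2 volume)
    (hξs : Function.support ξ ⊆ Icc (-a) a) :
    ∃ η : ℕ → ℝ → ℂ, (∀ n, IsLaurentPolynomial a (η n)) ∧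
      Tendsto (fun n ↦ ∫ x, ‖η n x - ξ x‖ ^ 2) atTop (𝓝 0) :=
  Yoshida1992.exists_W_seq_tendsto_integral_norm_sq ha hξ hξs

/-- **Prop. 2.3 from Lemma 2.2** (PROVED implication `lemma_2_2 → prop_2_3`): clause (i) is
unconditional (`prop_2_3_i`); clause (ii) on the domain is `exists_laurent_recovery_of_mem_formDomain`;
off the domain any `L²`-approximating sequence of Laurent polynomials works
(`tendsto_semilocalWeilForm_top_of_not_lt_top`), and such a sequence exists by the density of
`E = ∪_N E_N` in `L²([−a, a])` (`exists_laurent_tendsto_integral_norm_sq`). [cite: ConnesConsani2023, Prop. 2.3 and its proof («follows from Lemma 2.2 using Proposition 2.1»), p. 106 (arXiv chunk p0007:L70–L80)] -/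
theorem prop_2_3_of_lemma_2_2 (h : lemma_2_2) : prop_2_3 := by
  intro a ha ξ hξ hξs
  refine ⟨fun η hη hconv ↦
    semilocalWeilForm_le_liminf_of_isLaurentPolynomial ha hξ hξs hη hconv, ?_⟩
  by_cases hE : logSobolevEnergy ξ < ∞
  · exact exists_laurent_recovery_of_mem_formDomain h ha ⟨hξ, hξs, hE⟩
  · obtain ⟨η, hη, hconv⟩ := exists_laurent_tendsto_integral_norm_sq ha hξ hξs
    refine ⟨η, hη, hconv, ?_⟩
    rw [semilocalWeilForm_of_not_lt_top hE]
    exact tendsto_semilocalWeilForm_top_of_not_lt_top ha hξ hξs hE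
      (fun n ↦ (hη n).memLp_and_support ha) hconv

/-! ## §D Cor. 2.4 from Lemma 2.2 -/

/-- **Homogeneity** `E_N(c η) = |c|² E_N(η)` of the finite-prime form (a hermitian form).
[cite: ConnesConsani2023, Prop. 2.1 (QW_λ is a quadratic form, (2.11)), p. 103 (arXiv chunk p0006:L55–L60)] -/
theorem weilFinitePrimeQuadratic_smul (N : ℕ) (c : ℂ) (η : ℝ → ℂ) :
    weilFinitePrimeQuadratic N (c • η) = ‖c‖ ^ 2 * weilFinitePrimeQuadratic N η := by
  have hm : ∀ s, weilMellin (c • η) s = c * weilMellin η s := fun s ↦ by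
    rw [show c • η = fun t ↦ c * η t from rfl]
    exact weilMellin_const_mul c η s
  have hn : weilNorm2Sq (c • η) = ‖c‖ ^ 2 * weilNorm2Sq η := by
    unfold weilNorm2Sq
    rw [← integral_const_mul]
    congr 1 with x
    simp [mul_pow]
  have hp : (c * weilMellin η 0 * conj (c * weilMellin η 1)).re =
      ‖c‖ ^ 2 * (weilMellin η 0 * conj (weilMellin η 1)).re := by
    rw [map_mul, show c * weilMellin η 0 * (conj c * conj (weilMellin η 1)) =
      (c * conj c) * (weilMellin η 0 * conj (weilMellin η 1)) by ring, Complex.mul_conj,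
      Complex.normSq_eq_norm_sq, Complex.re_ofReal_mul]
  have hi : ∫ t : ℝ, ‖c * weilMellin η (1 / 2 + t * I)‖ ^ 2 * weilFinitePrimeWeight N t =
      ‖c‖ ^ 2 * ∫ t : ℝ, ‖weilMellin η (1 / 2 + t * I)‖ ^ 2 * weilFinitePrimeWeight N t := by
    rw [← integral_const_mul]
    congr 1 with t
    rw [norm_mul, mul_pow]
    ring
  unfold weilFinitePrimeQuadratic
  simp_rw [hm]
  rw [hn, hp, hi]
  ring

/-- Continuity of the `L²` norm along `u_n → ξ` in `L²`: `∫|u_n|² → ∫|ξ|²`. [cite: ConnesConsani2023, Prop. 2.1 (the Hilbert space L²([λ⁻¹,λ], d*u)), p. 103 (arXiv chunk p0006:L55)] -/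
theorem tendsto_integral_norm_sq_of_tendsto_sub {ξ : ℝ → ℂ} {u : ℕ → ℝ → ℂ}
    (hξ : MemLp ξ 2 volume) (hu : ∀ n, MemLp (u n) 2 volume)
    (hconv : Tendsto (fun n ↦ ∫ x, ‖u n x - ξ x‖ ^ 2) atTop (𝓝 0)) :
    Tendsto (fun n ↦ ∫ x, ‖u n x‖ ^ 2) atTop (𝓝 (∫ x, ‖ξ x‖ ^ 2)) := by
  have hs : Tendsto (fun n ↦ Real.sqrt (∫ x, ‖u n x‖ ^ 2)) atTop
      (𝓝 (Real.sqrt (∫ x, ‖ξ x‖ ^ 2))) := by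
    rw [tendsto_iff_norm_sub_tendsto_zero]
    refine squeeze_zero (fun n ↦ norm_nonneg _) (fun n ↦ ?_) (by simpa using hconv.sqrt)
    rw [Real.norm_eq_abs]
    exact abs_sqrt_integral_norm_sq_sub_le (hu n) hξ
  have e : ∀ η : ℝ → ℂ, ∫ x, ‖η x‖ ^ 2 = (Real.sqrt (∫ x, ‖η x‖ ^ 2)) ^ 2 := fun η ↦
    (Real.sq_sqrt (integral_nonneg fun _ ↦ by positivity)).symm
  rw [e ξ]
  have eu : (fun n ↦ ∫ x, ‖u n x‖ ^ 2) = fun n ↦ (Real.sqrt (∫ x, ‖u n x‖ ^ 2)) ^ 2 :=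
    funext fun n ↦ e (u n)
  rw [eu]
  exact hs.pow 2

/-- **Cor. 2.4 from Lemma 2.2** (PROVED implication): if `E` is a core of `QW_λ`, the lower bound of
`QW_λ` is the limit of the (decreasing) smallest eigenvalues of its finite sections on `E_N`.  Given
`ε > 0`, a unit vector `ξ ∈ Dom` with `QW_λ(ξ) < inf + ε/2` is approximated in the graph norm by Laurent
polynomials `η_n` (Lemma 2.2); then `‖η_n‖₂ → 1`, `E(η_n) → E(ξ)` (graph-norm continuity), and the
normalised `η_n/‖η_n‖₂ ∈ E_{N_n}` has Rayleigh quotient `< inf + ε` for `n` large, so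
`lim_N λ_min(E_N) ≤ λ_min(E_{N_n}) < inf + ε`; the reverse inequality is `tendsto_finiteSectionMin_iInf`.
[cite: ConnesConsani2023, Cor. 2.4 and its proof, p. 106 (arXiv chunk p0007:L82)] -/
theorem cor_2_4_of_lemma_2_2 (h : lemma_2_2) : cor_2_4 := by
  intro a ha
  obtain ⟨hT, hle⟩ := tendsto_finiteSectionMin_iInf ha
  have hbddR : BddBelow (Set.range (finiteSectionMin a)) := by
    refine ⟨formLowerBound a, ?_⟩
    rintro _ ⟨N, rfl⟩
    exact formLowerBound_le_finiteSectionMin ha N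
  suffices hge : ⨅ N, finiteSectionMin a N ≤ formLowerBound a by
    rwa [le_antisymm hge hle] at hT
  refine le_of_forall_pos_le_add fun ε hε ↦ ?_
  have hDne : {x : ℝ | ∃ ξ ∈ formDomain a, ∫ t, ‖ξ t‖ ^ 2 = (1 : ℝ) ∧
      x = weilFinitePrimeQuadratic (primeCutoff a) ξ}.Nonempty :=
    (finiteSection_values_nonempty ha 0).mono (finiteSection_values_subset ha 0)
  obtain ⟨x, ⟨ξ, hξ, hξn, rfl⟩, hx⟩ := Real.lt_sInf_add_pos hDne (half_pos hε)
  -- `hx : E ξ < formLowerBound a + ε / 2`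
  obtain ⟨η, hηL, hconv⟩ := exists_laurent_tendsto_energy h ha hξ
  have hdom : ∀ n, η n ∈ formDomain a := fun n ↦ (hηL n).mem_formDomain ha
  have hu' : ∀ n, MemLp (η n) 2 volume ∧ Function.support (η n) ⊆ Icc (-a) a :=
    fun n ↦ ⟨(hdom n).1, (hdom n).2.1⟩
  have hL2 := tendsto_integral_norm_sq_sub_of_energy hξ.1 hξ.2.1 hu' hconv
  have hEt := tendsto_weilFinitePrimeQuadratic_of_energy ha hξ hdom hconv (primeCutoff a)
  have hn := tendsto_integral_norm_sq_of_tendsto_sub hξ.1 (fun n ↦ (hu' n).1) hL2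
  rw [hξn] at hn
  have hq : Tendsto (fun n ↦ weilFinitePrimeQuadratic (primeCutoff a) (η n) / ∫ x, ‖η n x‖ ^ 2)
      atTop (𝓝 (weilFinitePrimeQuadratic (primeCutoff a) ξ)) := by
    have := hEt.div hn one_ne_zero
    rw [div_one] at this
    exact this
  have hev1 : ∀ᶠ n in atTop, weilFinitePrimeQuadratic (primeCutoff a) (η n) / ∫ x, ‖η n x‖ ^ 2 <
      formLowerBound a + ε / 2 :=
    hq.eventually (gt_mem_nhds hx)
  have hev2 : ∀ᶠ n in atTop, (1 / 2 : ℝ) < ∫ x, ‖η n x‖ ^ 2 :=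
    hn.eventually (lt_mem_nhds (by norm_num))
  obtain ⟨n, h1, h2⟩ := (hev1.and hev2).exists
  obtain ⟨N, hN⟩ := hηL n
  set m : ℝ := ∫ x, ‖η n x‖ ^ 2 with hm_def
  have hm : 0 < m := by linarith
  set c : ℂ := ((1 / Real.sqrt m : ℝ) : ℂ) with hc_def
  have hc : ‖c‖ ^ 2 = 1 / m := by
    rw [hc_def, Complex.norm_real, Real.norm_eq_abs, sq_abs, div_pow, one_pow, Real.sq_sqrt hm.le]
  have hmem : c • η n ∈ Yoshida1992.W a N := Submodule.smul_mem _ _ hN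
  have hnorm1 : ∫ t, ‖(c • η n) t‖ ^ 2 = (1 : ℝ) := by
    have e : (fun t ↦ ‖(c • η n) t‖ ^ 2) = fun t ↦ ‖c‖ ^ 2 * ‖η n t‖ ^ 2 := by
      funext t
      simp [Pi.smul_apply, mul_pow]
    rw [e, integral_const_mul, hc, ← hm_def]
    field_simp
  have hval : weilFinitePrimeQuadratic (primeCutoff a) (c • η n) =
      weilFinitePrimeQuadratic (primeCutoff a) (η n) / m := by
    rw [weilFinitePrimeQuadratic_smul, hc]
    ring
  have hSmem : weilFinitePrimeQuadratic (primeCutoff a) (η n) / m ∈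
      {x : ℝ | ∃ η ∈ Yoshida1992.W a N, ∫ t, ‖η t‖ ^ 2 = (1 : ℝ) ∧
        x = weilFinitePrimeQuadratic (primeCutoff a) η} :=
    ⟨c • η n, hmem, hnorm1, hval.symm⟩
  have hmin : finiteSectionMin a N ≤ weilFinitePrimeQuadratic (primeCutoff a) (η n) / m :=
    csInf_le ((bddBelow_formDomain_values ha).mono (finiteSection_values_subset ha N)) hSmem
  calc ⨅ N, finiteSectionMin a N ≤ finiteSectionMin a N := ciInf_le hbddR N
    _ ≤ weilFinitePrimeQuadratic (primeCutoff a) (η n) / m := hmin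
    _ ≤ formLowerBound a + ε := by
        have : weilFinitePrimeQuadratic (primeCutoff a) (η n) / m < formLowerBound a + ε / 2 := h1
        linarith

/-! ## §E The discharges of `prop_2_3` and `cor_2_4` -/

/-- RH-FREE · **Prop. 2.3 of Connes–Consani (2023), PROVED** (discharge of the named fact `prop_2_3`):
`QW_λ` on `L²([λ⁻¹, λ])` is the lower semicontinuous relaxation of its restriction to the Laurent
polynomials — (i) `QW_λ(ξ) ≤ liminf QW_λ(η_n)` along every Laurent sequence `η_n → ξ` in `L²`, and
(ii) some Laurent sequence `η_n → ξ` has `QW_λ(η_n) → QW_λ(ξ)` — from `prop_2_3_of_lemma_2_2` and the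
tree's `lemma_2_2_holds` (`ZetaCyclesCoreProofs.lean`).
[cite: ConnesConsani2023, Prop. 2.3 and its proof («follows from Lemma 2.2 using Proposition 2.1»), p. 106 (arXiv chunk p0007:L70–L80)] -/
theorem prop_2_3_holds : prop_2_3 := prop_2_3_of_lemma_2_2 lemma_2_2_holds

/-- RH-FREE · **Cor. 2.4 of Connes–Consani (2023), PROVED** (discharge of the named fact `cor_2_4`):
the lower bound of `QW_λ` is the limit, as `N → ∞`, of the (decreasing) smallest eigenvalues of the
restrictions of `QW_λ` to the spaces `E_N` of Laurent polynomials of degree `≤ N` — from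
`cor_2_4_of_lemma_2_2` and the tree's `lemma_2_2_holds`.
[cite: ConnesConsani2023, Cor. 2.4 and its proof, p. 106 (arXiv chunk p0007:L82)] -/
theorem cor_2_4_holds : cor_2_4 := cor_2_4_of_lemma_2_2 lemma_2_2_holds

end Literature.NumberTheory.ConnesConsani2023

end
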